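import Summits.AtomisticToContinuum.Crystallization.Theorems.ChargedEnergyGapStressFreeFccB
import HarnessLib

/-!
# «StressFreeFcc» P-J FCC-W (lens-3 g61) — part 3 of 5 (sequel of `…ChargedEnergyGapStressFreeFccB`)

Split for the 400-line cap by the landing lane (hand-2 g31); the module docstring of part 1 (`…ChargedEnergyGapStressFreeFccA`) describes the whole node.  Same namespace; all FQNs unchanged.
0 sorry; standard axioms.
-/

noncomputable section
open scoped Classical
open Literature.MathematicalPhysics.StatisticalMechanics
open Literature.Geometry.DiscreteGeometry
open Summit.AtomisticToContinuum.Crystallization.Theses.PricedLinkCensus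
open Summit.AtomisticToContinuum.Crystallization.Theorems.ChargedEnergyGapNegative

namespace Summit.AtomisticToContinuum.Crystallization.Theorems.ChargedEnergyGapChartDial

namespace Fcc

/-! ## The virial sums on `D₃ ∖ 0` -/

section Sums

/-- The length of the lattice point `a·n`. -/
def len (a : ℝ) (n : D3) : ℝ := a * Real.sqrt (nsq n.1)

/-- `len_pos` (docstring added by the landing lane; see the module docstring). [formal bookkeeping] -/
theorem len_pos (a : ℝ) (ha : 0 < a) (n : D3) : 0 < len a n := mul_pos ha (Real.sqrt_pos.2 (nsq_pos n))

/-- `abs_coord_le_len` (docstring added by the landing lane; see the module docstring). [formal bookkeeping] -/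
theorem abs_coord_le_len (a : ℝ) (ha : 0 < a) (n : D3) (i : Fin 3) : |((n.1 i : ℝ)) * a| ≤ len a n := by
  have h := PiLp.norm_apply_le (vec a n.1) i
  rw [vec_apply, Real.norm_eq_abs, norm_vec a ha] at h
  exact h

/-- The `(i, j)` summand of the virial on `D₃ ∖ 0`. -/
def term (a : ℝ) (i j : Fin 3) (n : D3) : ℝ := F (len a n) * (((n.1 i : ℝ) * a) * ((n.1 j : ℝ) * a))

/-- The `(i, j)` entry of the virial tensor of the fcc lattice `a·D₃` (one-point motif). -/
def S (a : ℝ) (i j : Fin 3) : ℝ := ∑' n : D3, term a i j n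

/-- `summable_inv_len_pow` (docstring added by the landing lane; see the module docstring). [formal bookkeeping] -/
theorem summable_inv_len_pow (a : ℝ) (ha : 0 < a) {p : ℕ} (hp : 3 < p) : Summable fun n : D3 => ((len a n)⁻¹) ^ p := by
  have h := (fccRef a ha).summable_inv_pow_dist hp (0 : E3)
  rw [← (vecEquiv a ha).summable_iff] at h
  refine h.congr fun n => ?_
  simp only [Function.comp_apply, vecEquiv_apply, dist_zero_vec a ha]
  rfl

/-- `abs_term_le` (docstring added by the landing lane; see the module docstring). [formal bookkeeping] -/
theorem abs_term_le (a : ℝ) (ha : 0 < a) (i j : Fin 3) (n : D3) : |term a i j n| ≤ ((len a n)⁻¹) ^ 12 + ((len a n)⁻¹) ^ 6 := by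
  have hd := len_pos a ha n
  have hi := abs_coord_le_len a ha n i
  have hj := abs_coord_le_len a ha n j
  have h1 : |term a i j n| ≤ |F (len a n)| * (len a n) ^ 2 := by
    unfold term
    rw [abs_mul, abs_mul, sq]
    exact mul_le_mul_of_nonneg_left (mul_le_mul hi hj (abs_nonneg _) hd.le) (abs_nonneg _)
  exact h1.trans (abs_F_mul_sq_le hd)

/-- `summable_term` (docstring added by the landing lane; see the module docstring). [formal bookkeeping] -/
theorem summable_term (a : ℝ) (ha : 0 < a) (i j : Fin 3) : Summable (term a i j) :=
  Summable.of_norm_bounded ((summable_inv_len_pow a ha (by norm_num : 3 < 12)).add (summable_inv_len_pow a ha (by norm_num : 3 < 6)))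
    fun n => by rw [Real.norm_eq_abs]; exact abs_term_le a ha i j n

/-! ### Symmetries -/

/-- Coordinate negation as a permutation of `D₃ ∖ 0`. -/
theorem even_sum_negCoord (i : Fin 3) {n : Fin 3 → ℤ} (hn : Even (∑ k, n k)) : Even (∑ k, negCoord i n k) := by
  rw [sum_negCoord]
  exact hn.sub (even_two_mul _)

/-- `negEquiv` (docstring added by the landing lane; see the module docstring). [formal bookkeeping] -/
def negEquiv (i : Fin 3) : D3 ≃ D3 where
  toFun n := ⟨negCoord i n.1, negCoord_ne_zero i n.2.1, even_sum_negCoord i n.2.2⟩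
  invFun n := ⟨negCoord i n.1, negCoord_ne_zero i n.2.1, even_sum_negCoord i n.2.2⟩
  left_inv n := Subtype.ext (negCoord_negCoord i n.1)
  right_inv n := Subtype.ext (negCoord_negCoord i n.1)

/-- `len_negEquiv` (docstring added by the landing lane; see the module docstring). [formal bookkeeping] -/
theorem len_negEquiv (a : ℝ) (i : Fin 3) (n : D3) : len a (negEquiv i n) = len a n := by
  simp [len, negEquiv, nsq_negCoord]

/-- `term_negEquiv` (docstring added by the landing lane; see the module docstring). [formal bookkeeping] -/
theorem term_negEquiv {i j : Fin 3} (hij : i ≠ j) (a : ℝ) (n : D3) : term a i j (negEquiv i n) = -term a i j n := by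
  simp only [term, len_negEquiv]
  simp [negEquiv, negCoord, hij.symm]

/-- ★ Off-diagonal virial entries vanish by the reflection symmetry. -/
theorem S_offDiag (a : ℝ) {i j : Fin 3} (hij : i ≠ j) : S a i j = 0 := by
  have h : S a i j = -S a i j := by
    calc S a i j = ∑' n : D3, term a i j (negEquiv i n) := ((negEquiv i).tsum_eq (term a i j)).symm
      _ = ∑' n : D3, -term a i j n := by simp_rw [term_negEquiv hij]
      _ = -S a i j := tsum_neg
  linarith

/-- Coordinate swap as a permutation of `D₃ ∖ 0`. -/
theorem even_sum_swapCoord (i : Fin 3) {n : Fin 3 → ℤ} (hn : Even (∑ k, n k)) : Even (∑ k, swapCoord i n k) := by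
  rw [sum_swapCoord]; exact hn

/-- `swapEquiv` (docstring added by the landing lane; see the module docstring). [formal bookkeeping] -/
def swapEquiv (i : Fin 3) : D3 ≃ D3 where
  toFun n := ⟨swapCoord i n.1, swapCoord_ne_zero i n.2.1, even_sum_swapCoord i n.2.2⟩
  invFun n := ⟨swapCoord i n.1, swapCoord_ne_zero i n.2.1, even_sum_swapCoord i n.2.2⟩
  left_inv n := Subtype.ext (swapCoord_swapCoord i n.1)
  right_inv n := Subtype.ext (swapCoord_swapCoord i n.1)

/-- `len_swapEquiv` (docstring added by the landing lane; see the module docstring). [formal bookkeeping] -/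
theorem len_swapEquiv (a : ℝ) (i : Fin 3) (n : D3) : len a (swapEquiv i n) = len a n := by
  simp [len, swapEquiv, nsq_swapCoord]

/-- `term_swapEquiv` (docstring added by the landing lane; see the module docstring). [formal bookkeeping] -/
theorem term_swapEquiv (a : ℝ) (i : Fin 3) (n : D3) : term a i i (swapEquiv i n) = term a 0 0 n := by
  simp only [term, len_swapEquiv]
  simp [swapEquiv, swapCoord, Equiv.swap_apply_right]

/-- ★ Diagonal virial entries coincide by the coordinate-swap symmetry. -/
theorem S_diag_eq (a : ℝ) (i : Fin 3) : S a i i = S a 0 0 := by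
  calc S a i i = ∑' n : D3, term a i i (swapEquiv i n) := ((swapEquiv i).tsum_eq (term a i i)).symm
    _ = S a 0 0 := by simp_rw [term_swapEquiv]; rfl

/-! ### The trace and the stress-free spacing -/

/-- `A = Σ |n|⁻¹²`, `B = Σ |n|⁻⁶` over `D₃ ∖ 0` (the Epstein zeta values `Z_{D₃}(12)`, `Z_{D₃}(6)` of the lattice `D₃`). -/
def epsteinA : ℝ := ∑' n : D3, ((len 1 n)⁻¹) ^ 12
/-- `epsteinB` (docstring added by the landing lane; see the module docstring). [formal bookkeeping] -/
def epsteinB : ℝ := ∑' n : D3, ((len 1 n)⁻¹) ^ 6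

/-- `len_eq` (docstring added by the landing lane; see the module docstring). [formal bookkeeping] -/
theorem len_eq (a : ℝ) (n : D3) : len a n = a * len 1 n := by simp [len]

/-- `one_le_len_one` (docstring added by the landing lane; see the module docstring). [formal bookkeeping] -/
theorem one_le_len_one (n : D3) : 1 ≤ len 1 n := by
  rw [len, one_mul]
  calc (1 : ℝ) = Real.sqrt 1 := Real.sqrt_one.symm
    _ ≤ Real.sqrt (nsq n.1) := Real.sqrt_le_sqrt (one_le_nsq n)

/-- The nearest-neighbour vector `(1,1,0) ∈ D₃ ∖ 0`. -/
def e0 : D3 := ⟨fun k => if k = 2 then 0 else 1, fun h => by simpa using congrArg (fun f : Fin 3 → ℤ => f 0) h,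
  ⟨1, by simp [Fin.sum_univ_three]⟩⟩

/-- `nsq_e0` (docstring added by the landing lane; see the module docstring). [formal bookkeeping] -/
theorem nsq_e0 : nsq e0.1 = 2 := by
  simp [nsq, e0, Fin.sum_univ_three]; norm_num

/-- `len_one_e0` (docstring added by the landing lane; see the module docstring). [formal bookkeeping] -/
theorem len_one_e0 : len 1 e0 = Real.sqrt 2 := by simp [len, nsq_e0]

/-- `epsteinA_pos` (docstring added by the landing lane; see the module docstring). [formal bookkeeping] -/
theorem epsteinA_pos : 0 < epsteinA :=
  (summable_inv_len_pow 1 one_pos (by norm_num : 3 < 12)).tsum_pos (fun n => pow_nonneg (inv_nonneg.2 (len_pos 1 one_pos n).le) _) e0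
    (by rw [len_one_e0]; positivity)

/-- `epsteinB_pos` (docstring added by the landing lane; see the module docstring). [formal bookkeeping] -/
theorem epsteinB_pos : 0 < epsteinB :=
  (summable_inv_len_pow 1 one_pos (by norm_num : 3 < 6)).tsum_pos (fun n => pow_nonneg (inv_nonneg.2 (len_pos 1 one_pos n).le) _) e0
    (by rw [len_one_e0]; positivity)

/-- `epsteinA_le_epsteinB` (docstring added by the landing lane; see the module docstring). [formal bookkeeping] -/
theorem epsteinA_le_epsteinB : epsteinA ≤ epsteinB := by
  refine (summable_inv_len_pow 1 one_pos (by norm_num : 3 < 12)).tsum_le_tsum (fun n => ?_)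
    (summable_inv_len_pow 1 one_pos (by norm_num : 3 < 6))
  have h0 : 0 ≤ (len 1 n)⁻¹ := inv_nonneg.2 (len_pos 1 one_pos n).le
  have h1 : (len 1 n)⁻¹ ≤ 1 := inv_le_one_of_one_le₀ (one_le_len_one n)
  exact pow_le_pow_of_le_one h0 h1 (by norm_num)

/-- ★ The trace of the virial: `Σ_i S_ii(a) = −a⁻¹²·A + a⁻⁶·B`. -/
theorem S_trace (a : ℝ) (ha : 0 < a) : ∑ i, S a i i = -((a⁻¹) ^ 12 * epsteinA) + (a⁻¹) ^ 6 * epsteinB := by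
  have hsum : ∀ n : D3, ∑ i, term a i i n = -((len a n)⁻¹) ^ 12 + ((len a n)⁻¹) ^ 6 := fun n => by
    have hq : ∑ i, ((n.1 i : ℝ) * a) * ((n.1 i : ℝ) * a) = (len a n) ^ 2 := by
      rw [len, mul_pow, Real.sq_sqrt (nsq_nonneg n.1), nsq, Finset.mul_sum]
      exact Finset.sum_congr rfl fun i _ => by ring
    simp only [term]
    rw [← Finset.mul_sum, hq, F_mul_sq (len_pos a ha n)]
  simp only [S]
  rw [← Summable.tsum_finsetSum (fun i _ => summable_term a ha i i)]
  simp_rw [hsum]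
  have h12 := summable_inv_len_pow a ha (by norm_num : 3 < 12)
  have h6 := summable_inv_len_pow a ha (by norm_num : 3 < 6)
  rw [h12.neg.tsum_add h6, tsum_neg]
  have e12 : ∑' n : D3, ((len a n)⁻¹) ^ 12 = (a⁻¹) ^ 12 * epsteinA := by
    rw [epsteinA, ← tsum_mul_left]; exact tsum_congr fun n => by rw [len_eq a n, mul_inv, mul_pow]
  have e6 : ∑' n : D3, ((len a n)⁻¹) ^ 6 = (a⁻¹) ^ 6 * epsteinB := by
    rw [epsteinB, ← tsum_mul_left]; exact tsum_congr fun n => by rw [len_eq a n, mul_inv, mul_pow]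
  rw [e12, e6]

/-- ★ THE STRESS-FREE CUBIC PARAMETER `a₀ = (A/B)^{1/6}` of the fcc Lennard-Jones lattice `a₀·D₃` (nearest-neighbour distance `a₀√2`). -/
def a0 : ℝ := (epsteinA / epsteinB) ^ ((6 : ℕ)⁻¹ : ℝ)

/-- `a0_pos` (docstring added by the landing lane; see the module docstring). [formal bookkeeping] -/
theorem a0_pos : 0 < a0 := Real.rpow_pos_of_pos (div_pos epsteinA_pos epsteinB_pos) _

/-- `a0_pow_six` (docstring added by the landing lane; see the module docstring). [formal bookkeeping] -/
theorem a0_pow_six : a0 ^ 6 = epsteinA / epsteinB :=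
  Real.rpow_inv_natCast_pow (div_pos epsteinA_pos epsteinB_pos).le (by norm_num)

/-- `a0_le_one` (docstring added by the landing lane; see the module docstring). [formal bookkeeping] -/
theorem a0_le_one : a0 ≤ 1 :=
  Real.rpow_le_one (div_pos epsteinA_pos epsteinB_pos).le ((div_le_one epsteinB_pos).2 epsteinA_le_epsteinB) (by positivity)

/-- ★ At `a₀` the trace of the virial vanishes. -/
theorem S_trace_a0 : ∑ i, S a0 i i = 0 := by
  rw [S_trace a0 a0_pos]
  have hB := epsteinB_pos.ne'
  have ha := a0_pos.ne'
  have h6 : (a0⁻¹) ^ 6 = epsteinB / epsteinA := by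
    rw [inv_pow, a0_pow_six, inv_div]
  have h12 : (a0⁻¹) ^ 12 = (epsteinB / epsteinA) ^ 2 := by
    rw [← h6]; ring
  rw [h12, h6]
  field_simp
  ring

/-- ★★ Every virial entry of the fcc lattice `a₀·D₃` vanishes. -/
theorem S_a0_eq_zero (i j : Fin 3) : S a0 i j = 0 := by
  by_cases hij : i = j
  · subst hij
    have h3 : ∑ k, S a0 k k = 3 * S a0 0 0 := by
      rw [Fin.sum_univ_three, S_diag_eq a0 1, S_diag_eq a0 2]; ring
    have h0 : S a0 0 0 = 0 := by have := S_trace_a0; rw [h3] at this; linarith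
    rw [S_diag_eq, h0]
  · exact S_offDiag a0 hij

end Sums

end Fcc

end Summit.AtomisticToContinuum.Crystallization.Theorems.ChargedEnergyGapChartDial

end
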